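import Mathlib.Analysis.SpecialFunctions.Exp
import Mathlib.Analysis.Real.Pi.Bounds
import Mathlib.Analysis.Normed.Group.FunctionSeries
import Mathlib.Analysis.Calculus.ParametricIntegral
import Mathlib.Analysis.SpecialFunctions.ImproperIntegrals
import Mathlib.MeasureTheory.Integral.Bochner.ContinuousLinearMap
import Literature.NumberTheory.LFunctions.DeBruijnNewman
import HarnessLib

/-!
# Analytic properties of the Pólya–de Bruijn kernel `Φ` and of de Bruijn's family `H_t` — proofs

Trunk T-ANT, `Literature/NumberTheory/LFunctions`; companion ("Proofs") file of
`DeBruijnNewman.lean`, discharging its elementary named facts and supplying the analytic inputs of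
Hurwitz's theorem used for Newman's characterisation of `Λ`
(`Literature/NumberTheory/LFunctions/EquivalentsProofs.lean`).

## Contents (all proved)

* `Literature.NumberTheory.LFunctions.summable_deBruijnPhi_holds`: the series for `Φ(u)` converges for every real `u`
  (discharges `Literature.NumberTheory.LFunctions.summable_deBruijnPhi`).
* `Literature.NumberTheory.LFunctions.abs_deBruijnPhiSummand_le`, `Literature.NumberTheory.LFunctions.continuousOn_deBruijnPhi_Ici`, `Literature.NumberTheory.LFunctions.deBruijnPhi_pos_of_nonneg`:
  on `u ≥ 0` the summands are dominated by a summable sequence times `exp(9u − π e^{4u})`, so `Φ` is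
  continuous on `[0, ∞)`, positive there, and
* `Literature.NumberTheory.LFunctions.deBruijnPhi_le_exp_holds`: `Φ(u) ≤ C exp(9u − π e^{4u})` for `u ≥ 0`
  (discharges `Literature.NumberTheory.LFunctions.deBruijnPhi_le_exp`).
* `Literature.integrableOn_deBruijnH_bound`: `u ↦ e^{T u²} Φ(u) e^{Y u}` is integrable on `(0, ∞)`.
* `Literature.NumberTheory.LFunctions.differentiable_deBruijnH_holds`: each `H_t` is entire (discharges
  `Literature.NumberTheory.LFunctions.differentiable_deBruijnH`), by differentiation under the integral sign.
* `Literature.NumberTheory.LFunctions.continuous_deBruijnH_uncurry`: `(t, z) ↦ H_t(z)` is jointly continuous (dominated convergence).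
* `Literature.NumberTheory.LFunctions.deBruijnH_apply_zero_pos`, `Literature.deBruijnH_ne_zero`: `H_t(0) = ∫₀^∞ e^{tu²} Φ(u) du > 0`, so no
  `H_t` vanishes identically.

These are the textbook facts quoted in Rodgers–Tao 2020, §1 ("`Φ` is super-exponentially
decaying", "`H_t` is an entire even function") and Csordas–Norfolk–Varga 1986, Thm. A; the
proofs here are self-contained real analysis (positivity of `Φ` is only needed and only proved on
`[0, ∞)`, where each summand is positive because `2π e^{4u} n² ≥ 2π > 3`).

## References

* B. Rodgers, T. Tao, *The de Bruijn–Newman constant is non-negative*, Forum Math. Pi 8 (2020), §1.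
* G. Csordas, T. S. Norfolk, R. S. Varga, *The Riemann hypothesis and the Turán inequalities*,
  Trans. AMS 296 (1986), Thm. A.
* E. C. Titchmarsh, *The theory of the Riemann zeta-function*, 2nd ed., §10.1.
-/

noncomputable section

open Complex MeasureTheory Real Set Filter Topology

namespace Literature.NumberTheory.LFunctions

/-! ## The kernel `Φ`: summability, continuity, positivity and decay on `[0, ∞)` -/

/-- The polynomial-times-Gaussian majorant `M n = 5π² (n+1)⁴ e^{π} e^{−π (n+1)²}`. [folklore] -/
def deBruijnPhiMajorant (n : ℕ) : ℝ :=
  5 * π ^ 2 * ((n : ℝ) + 1) ^ 4 * (Real.exp π * Real.exp (-(π * ((n : ℝ) + 1) ^ 2)))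

/-- `M n ≥ 0`. [folklore] -/
theorem deBruijnPhiMajorant_nonneg (n : ℕ) : 0 ≤ deBruijnPhiMajorant n := by
  unfold deBruijnPhiMajorant; positivity

/-- `∑ (n+1)^k e^{−r (n+1)}` converges for `r > 0`. [folklore] -/
theorem summable_succ_pow_mul_exp_neg_mul (k : ℕ) {r : ℝ} (hr : 0 < r) :
    Summable fun n : ℕ ↦ ((n : ℝ) + 1) ^ k * Real.exp (-(r * ((n : ℝ) + 1))) := by
  have := (summable_nat_add_iff (f := fun n : ℕ ↦ (n : ℝ) ^ k * Real.exp (-r * n)) 1).2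
    (Real.summable_pow_mul_exp_neg_nat_mul k hr)
  refine this.congr fun n ↦ ?_
  push_cast
  ring_nf

/-- `(n+1)^k e^{−r (n+1)²} ≤ (n+1)^k e^{−r (n+1)}` termwise, so the Gaussian version is summable
too. [folklore] -/
theorem summable_succ_pow_mul_exp_neg_mul_sq (k : ℕ) {r : ℝ} (hr : 0 < r) :
    Summable fun n : ℕ ↦ ((n : ℝ) + 1) ^ k * Real.exp (-(r * ((n : ℝ) + 1) ^ 2)) := by
  refine (summable_succ_pow_mul_exp_neg_mul k hr).of_nonneg_of_le (fun n ↦ by positivity)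
    fun n ↦ ?_
  gcongr
  nlinarith [(Nat.cast_nonneg n : (0 : ℝ) ≤ n)]

/-- `∑ M n < ∞`. [folklore] -/
theorem summable_deBruijnPhiMajorant : Summable deBruijnPhiMajorant := by
  have := (summable_succ_pow_mul_exp_neg_mul_sq 4 Real.pi_pos).mul_left (5 * π ^ 2 * Real.exp π)
  refine this.congr fun n ↦ ?_
  unfold deBruijnPhiMajorant; ring

/-- **Discharge** of `Literature.NumberTheory.LFunctions.summable_deBruijnPhi`: the series for `Φ(u)` converges for every real
`u` (comparison with `∑ (n+1)⁴ e^{−π e^{4u} (n+1)}`). [cite: Titchmarsh1986, §10.1] -/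
theorem summable_deBruijnPhi_holds : summable_deBruijnPhi := by
  intro u
  set s : ℝ := Real.exp (4 * u) with hs
  have hspos : 0 < s := Real.exp_pos _
  have hmaj := (summable_succ_pow_mul_exp_neg_mul 4 (mul_pos Real.pi_pos hspos)).mul_left
    (2 * π ^ 2 * Real.exp (9 * u) + 3 * π * Real.exp (5 * u))
  refine hmaj.of_norm_bounded fun n ↦ ?_
  have hn1 : (1 : ℝ) ≤ (n : ℝ) + 1 := by simp
  set m : ℝ := (n : ℝ) + 1 with hm
  rw [Real.norm_eq_abs, deBruijnPhiSummand]
  have hexp : Real.exp (-(π * m ^ 2 * s)) ≤ Real.exp (-(π * s * m)) := by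
    apply Real.exp_monotone
    have : m ≤ m ^ 2 := by nlinarith
    nlinarith [mul_pos Real.pi_pos hspos, this]
  calc |(2 * π ^ 2 * m ^ 4 * Real.exp (9 * u) - 3 * π * m ^ 2 * Real.exp (5 * u)) *
          Real.exp (-(π * m ^ 2 * Real.exp (4 * u)))|
      = |2 * π ^ 2 * m ^ 4 * Real.exp (9 * u) - 3 * π * m ^ 2 * Real.exp (5 * u)| *
          Real.exp (-(π * m ^ 2 * s)) := by
        rw [abs_mul, abs_of_pos (Real.exp_pos _)]
    _ ≤ (2 * π ^ 2 * m ^ 4 * Real.exp (9 * u) + 3 * π * m ^ 4 * Real.exp (5 * u)) *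
          Real.exp (-(π * s * m)) := by
        gcongr
        refine (abs_sub _ _).trans ?_
        rw [abs_of_nonneg (by positivity), abs_of_nonneg (by positivity)]
        gcongr 2 * π ^ 2 * m ^ 4 * Real.exp (9 * u) + 3 * π * ?_ * Real.exp (5 * u)
        exact pow_le_pow_right₀ hn1 (by norm_num)
    _ = (2 * π ^ 2 * Real.exp (9 * u) + 3 * π * Real.exp (5 * u)) *
          (m ^ 4 * Real.exp (-(π * s * m))) := by ring

/-- For `u ≥ 0`: `9u − π e^{4u} ≤ −π` (since `e^{4u} ≥ 1 + 4u` and `4π ≥ 9`). [folklore] -/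
theorem nine_mul_sub_pi_mul_exp_le {u : ℝ} (hu : 0 ≤ u) :
    9 * u - π * Real.exp (4 * u) ≤ -π := by
  have h1 : 4 * u + 1 ≤ Real.exp (4 * u) := Real.add_one_le_exp _
  nlinarith [Real.pi_gt_three, Real.pi_pos]

/-- Termwise domination on `u ≥ 0`:
`|Φₙ(u)| ≤ M n · exp(9u − π e^{4u})`. [folklore] -/
theorem abs_deBruijnPhiSummand_le (n : ℕ) {u : ℝ} (hu : 0 ≤ u) :
    |deBruijnPhiSummand n u| ≤
      deBruijnPhiMajorant n * Real.exp (9 * u - π * Real.exp (4 * u)) := by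
  set m : ℝ := (n : ℝ) + 1 with hm
  have hm1 : (1 : ℝ) ≤ m := by simp [hm]
  set s : ℝ := Real.exp (4 * u) with hs
  have hs1 : 1 ≤ s := Real.one_le_exp (by linarith)
  have h5 : Real.exp (5 * u) ≤ Real.exp (9 * u) := Real.exp_monotone (by linarith)
  -- the Gaussian factor: `exp(−π m² s) ≤ exp(−π s) · exp(π) · exp(−π m²)`
  have hgauss : Real.exp (-(π * m ^ 2 * s)) ≤
      Real.exp (-(π * s)) * (Real.exp π * Real.exp (-(π * m ^ 2))) := by
    rw [← Real.exp_add, ← Real.exp_add]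
    apply Real.exp_monotone
    have : 0 ≤ (m ^ 2 - 1) * (s - 1) := mul_nonneg (by nlinarith) (by linarith)
    nlinarith [Real.pi_pos]
  have hpoly : |2 * π ^ 2 * m ^ 4 * Real.exp (9 * u) - 3 * π * m ^ 2 * Real.exp (5 * u)| ≤
      5 * π ^ 2 * m ^ 4 * Real.exp (9 * u) := by
    refine (abs_sub _ _).trans ?_
    rw [abs_of_nonneg (by positivity), abs_of_nonneg (by positivity)]
    have : 3 * π * m ^ 2 * Real.exp (5 * u) ≤ 3 * π ^ 2 * m ^ 4 * Real.exp (9 * u) := by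
      gcongr 3 * ?_ * ?_ * ?_
      · nlinarith [Real.pi_gt_three]
      · exact pow_le_pow_right₀ hm1 (by norm_num)
    linarith
  calc |deBruijnPhiSummand n u|
      = |2 * π ^ 2 * m ^ 4 * Real.exp (9 * u) - 3 * π * m ^ 2 * Real.exp (5 * u)| *
          Real.exp (-(π * m ^ 2 * s)) := by
        rw [deBruijnPhiSummand, abs_mul, abs_of_pos (Real.exp_pos _)]
    _ ≤ 5 * π ^ 2 * m ^ 4 * Real.exp (9 * u) *
          (Real.exp (-(π * s)) * (Real.exp π * Real.exp (-(π * m ^ 2)))) := by gcongr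
    _ = deBruijnPhiMajorant n * Real.exp (9 * u - π * Real.exp (4 * u)) := by
        rw [deBruijnPhiMajorant, sub_eq_add_neg, Real.exp_add]
        ring

/-- On `u ≥ 0` the summands are dominated by the summable sequence `M n`. [folklore] -/
theorem abs_deBruijnPhiSummand_le_majorant (n : ℕ) {u : ℝ} (hu : 0 ≤ u) :
    |deBruijnPhiSummand n u| ≤ deBruijnPhiMajorant n := by
  refine (abs_deBruijnPhiSummand_le n hu).trans ?_
  have : Real.exp (9 * u - π * Real.exp (4 * u)) ≤ 1 :=
    Real.exp_le_one_iff.2 (by linarith [nine_mul_sub_pi_mul_exp_le hu, Real.pi_pos])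
  simpa using mul_le_mul_of_nonneg_left this (deBruijnPhiMajorant_nonneg n)

/-- Each summand of `Φ` is continuous. [folklore] -/
theorem continuous_deBruijnPhiSummand (n : ℕ) : Continuous (deBruijnPhiSummand n) := by
  unfold deBruijnPhiSummand; fun_prop

/-- `Φ` is continuous on `[0, ∞)` (uniformly convergent series of continuous functions).
[cite: Titchmarsh1986, §10.1] -/
theorem continuousOn_deBruijnPhi_Ici : ContinuousOn deBruijnPhi (Ici 0) := by
  refine continuousOn_tsum (fun n ↦ (continuous_deBruijnPhiSummand n).continuousOn)
    summable_deBruijnPhiMajorant fun n u hu ↦ ?_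
  rw [Real.norm_eq_abs]
  exact abs_deBruijnPhiSummand_le_majorant n hu

/-- Each summand of `Φ` is positive on `u ≥ 0`, because `2π (n+1)² e^{4u} ≥ 2π > 3`. [folklore] -/
theorem deBruijnPhiSummand_pos (n : ℕ) {u : ℝ} (hu : 0 ≤ u) : 0 < deBruijnPhiSummand n u := by
  unfold deBruijnPhiSummand
  refine mul_pos ?_ (Real.exp_pos _)
  set m : ℝ := (n : ℝ) + 1 with hm
  have hm1 : (1 : ℝ) ≤ m := by simp [hm]
  have h4 : 1 ≤ Real.exp (4 * u) := Real.one_le_exp (by linarith)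
  have h9 : Real.exp (9 * u) = Real.exp (5 * u) * Real.exp (4 * u) := by
    rw [← Real.exp_add]; ring_nf
  rw [h9, sub_pos]
  have h5 : 0 < Real.exp (5 * u) := Real.exp_pos _
  have hm2 : 1 ≤ m ^ 2 := by nlinarith
  -- `3 π m² e^{5u} < 2 π² m⁴ e^{5u} e^{4u}`
  have : 3 * π * m ^ 2 < 2 * π ^ 2 * m ^ 4 * Real.exp (4 * u) := by
    have hm4 : m ^ 2 ≤ m ^ 4 := pow_le_pow_right₀ hm1 (by norm_num)
    have hπm : 0 < π * m ^ 2 := by positivity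
    have h' : 3 * π * m ^ 2 < 2 * π ^ 2 * m ^ 4 := by
      have h3 : (3 : ℝ) < 2 * π := by linarith [Real.pi_gt_three]
      have := mul_lt_mul_of_pos_right h3 hπm
      nlinarith [mul_le_mul_of_nonneg_left hm4 (by positivity : (0 : ℝ) ≤ 2 * π ^ 2)]
    have h'' : 0 ≤ 2 * π ^ 2 * m ^ 4 := by positivity
    nlinarith [mul_le_mul_of_nonneg_left h4 h'']
  nlinarith

/-- `Φ(u) > 0` for `u ≥ 0` (the elementary half of `Literature.NumberTheory.LFunctions.deBruijnPhi_pos`; positivity for `u < 0`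
is Pólya's theorem and needs the theta functional equation). [folklore] -/
theorem deBruijnPhi_pos_of_nonneg {u : ℝ} (hu : 0 ≤ u) : 0 < deBruijnPhi u :=
  (summable_deBruijnPhi_holds u).tsum_pos (fun n ↦ (deBruijnPhiSummand_pos n hu).le) 0
    (deBruijnPhiSummand_pos 0 hu)

/-- **Discharge** of `Literature.NumberTheory.LFunctions.deBruijnPhi_le_exp`: `Φ(u) ≤ C exp(9u − π e^{4u})` for `u ≥ 0`, with
`C = ∑ M n`. [cite: RodgersTao2020, §1] -/
theorem deBruijnPhi_le_exp_holds : deBruijnPhi_le_exp := by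
  refine ⟨∑' n, deBruijnPhiMajorant n, fun u hu ↦ ?_⟩
  rw [deBruijnPhi, ← tsum_mul_right]
  refine (summable_deBruijnPhi_holds u).tsum_le_tsum (fun n ↦ ?_)
    (summable_deBruijnPhiMajorant.mul_right _)
  exact (le_abs_self _).trans (abs_deBruijnPhiSummand_le n hu)

/-- Two-sided version: `|Φ(u)| ≤ (∑ M n) exp(9u − π e^{4u})` for `u ≥ 0`. [folklore] -/
theorem abs_deBruijnPhi_le {u : ℝ} (hu : 0 ≤ u) :
    |deBruijnPhi u| ≤ (∑' n, deBruijnPhiMajorant n) * Real.exp (9 * u - π * Real.exp (4 * u)) := by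
  rw [abs_of_pos (deBruijnPhi_pos_of_nonneg hu), deBruijnPhi, ← tsum_mul_right]
  refine (summable_deBruijnPhi_holds u).tsum_le_tsum (fun n ↦ ?_)
    (summable_deBruijnPhiMajorant.mul_right _)
  exact (le_abs_self _).trans (abs_deBruijnPhiSummand_le n hu)

/-! ## Elementary bounds -/

/-- `‖cos w‖ ≤ e^{|Im w|}`. [folklore] -/
theorem norm_cos_le_exp_abs_im (w : ℂ) : ‖Complex.cos w‖ ≤ Real.exp |w.im| := by
  have h2 : (2 : ℝ) * ‖Complex.cos w‖ = ‖Complex.exp (w * I) + Complex.exp (-w * I)‖ := by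
    rw [← Complex.two_cos, norm_mul, Complex.norm_two]
  have ha : ‖Complex.exp (w * I)‖ ≤ Real.exp |w.im| := by
    rw [Complex.norm_exp]
    exact Real.exp_monotone (by simp [neg_le_abs])
  have hb : ‖Complex.exp (-w * I)‖ ≤ Real.exp |w.im| := by
    rw [Complex.norm_exp]
    exact Real.exp_monotone (by simp [le_abs_self])
  linarith [norm_add_le (Complex.exp (w * I)) (Complex.exp (-w * I))]

/-- `‖sin w‖ ≤ e^{|Im w|}`. [folklore] -/
theorem norm_sin_le_exp_abs_im (w : ℂ) : ‖Complex.sin w‖ ≤ Real.exp |w.im| := by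
  have h2 : (2 : ℝ) * ‖Complex.sin w‖ = ‖Complex.exp (-w * I) - Complex.exp (w * I)‖ := by
    rw [← Complex.norm_two, ← norm_mul, Complex.two_sin, norm_mul, Complex.norm_I, mul_one]
  have ha : ‖Complex.exp (w * I)‖ ≤ Real.exp |w.im| := by
    rw [Complex.norm_exp]
    exact Real.exp_monotone (by simp [neg_le_abs])
  have hb : ‖Complex.exp (-w * I)‖ ≤ Real.exp |w.im| := by
    rw [Complex.norm_exp]
    exact Real.exp_monotone (by simp [le_abs_self])
  linarith [norm_sub_le (Complex.exp (-w * I)) (Complex.exp (w * I))]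

/-- For `u ≥ 0`: `u ≤ e^{u}`, `u ≤ e^{2u}` and `u² ≤ e^{2u}`. [folklore] -/
theorem self_le_exp_two_mul {u : ℝ} (hu : 0 ≤ u) : u ≤ Real.exp (2 * u) := by
  have := Real.add_one_le_exp (2 * u); linarith

/-- For `u ≥ 0`: `u² ≤ e^{2u}`. [folklore] -/
theorem sq_le_exp_two_mul {u : ℝ} (hu : 0 ≤ u) : u ^ 2 ≤ Real.exp (2 * u) := by
  have h1 : u ≤ Real.exp u := by have := Real.add_one_le_exp u; linarith
  rw [two_mul, Real.exp_add]
  nlinarith [Real.exp_pos u]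

/-! ## The family `H_t`: the integrand and its dominating function -/

/-- The integrand `e^{tu²} Φ(u) cos(zu)` of `H_t(z)`, exactly as in `Literature.NumberTheory.LFunctions.deBruijnH`. [folklore] -/
def deBruijnHIntegrand (t : ℝ) (z : ℂ) (u : ℝ) : ℂ :=
  (Real.exp (t * u ^ 2) * deBruijnPhi u : ℂ) * Complex.cos (z * u)

/-- `H_t(z) = ∫₀^∞ deBruijnHIntegrand t z` (definitional). [folklore] -/
theorem deBruijnH_eq_integral (t : ℝ) (z : ℂ) :
    deBruijnH t z = ∫ u in Ioi (0 : ℝ), deBruijnHIntegrand t z u := rfl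

/-- The `z`-derivative `−u e^{tu²} Φ(u) sin(zu)` of the integrand. [folklore] -/
def deBruijnHIntegrand' (t : ℝ) (z : ℂ) (u : ℝ) : ℂ :=
  (Real.exp (t * u ^ 2) * deBruijnPhi u : ℂ) * (-Complex.sin (z * u) * u)

/-- The dominating function `e^{T u²} |Φ(u)| e^{Y u}`. [folklore] -/
def deBruijnHBound (T Y : ℝ) (u : ℝ) : ℝ :=
  Real.exp (T * u ^ 2) * |deBruijnPhi u| * Real.exp (Y * u)

/-- The dominating function is nonnegative. [folklore] -/
theorem deBruijnHBound_nonneg (T Y u : ℝ) : 0 ≤ deBruijnHBound T Y u := by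
  unfold deBruijnHBound; positivity

/-- The dominating function is continuous on `[0, ∞)`. [folklore] -/
theorem continuousOn_deBruijnHBound (T Y : ℝ) : ContinuousOn (deBruijnHBound T Y) (Ici 0) := by
  have h1 : Continuous fun u : ℝ ↦ Real.exp (T * u ^ 2) := by fun_prop
  have h2 : Continuous fun u : ℝ ↦ Real.exp (Y * u) := by fun_prop
  exact (h1.continuousOn.mul (continuous_abs.comp_continuousOn continuousOn_deBruijnPhi_Ici)).mul
    h2.continuousOn

/-- Domination of the integrand: `‖e^{tu²} Φ(u) cos(zu)‖ ≤ e^{Tu²} |Φ(u)| e^{Yu}` for `u ≥ 0`,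
`t ≤ T`, `|Im z| ≤ Y`. [folklore] -/
theorem norm_deBruijnHIntegrand_le {t T Y : ℝ} {z : ℂ} (ht : t ≤ T) (hz : |z.im| ≤ Y) {u : ℝ}
    (hu : 0 ≤ u) : ‖deBruijnHIntegrand t z u‖ ≤ deBruijnHBound T Y u := by
  unfold deBruijnHIntegrand deBruijnHBound
  rw [norm_mul, norm_mul, Complex.norm_real, Complex.norm_real, Real.norm_eq_abs,
    Real.norm_eq_abs, abs_of_pos (Real.exp_pos _)]
  have hcos : ‖Complex.cos (z * u)‖ ≤ Real.exp (Y * u) := by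
    refine (norm_cos_le_exp_abs_im _).trans (Real.exp_monotone ?_)
    rw [show (z * (u : ℂ)).im = z.im * u by simp, abs_mul, abs_of_nonneg hu]
    exact mul_le_mul_of_nonneg_right hz hu
  have hexp : Real.exp (t * u ^ 2) ≤ Real.exp (T * u ^ 2) := Real.exp_monotone (by nlinarith)
  gcongr

/-- Domination of the `z`-derivative of the integrand (one extra factor `u ≤ e^{u}`). [folklore] -/
theorem norm_deBruijnHIntegrand'_le {t T Y : ℝ} {z : ℂ} (ht : t ≤ T) (hz : |z.im| ≤ Y) {u : ℝ}
    (hu : 0 ≤ u) : ‖deBruijnHIntegrand' t z u‖ ≤ deBruijnHBound T (Y + 1) u := by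
  unfold deBruijnHIntegrand' deBruijnHBound
  rw [norm_mul, norm_mul, norm_mul, norm_neg, Complex.norm_real, Complex.norm_real,
    Complex.norm_real, Real.norm_eq_abs, Real.norm_eq_abs, Real.norm_eq_abs,
    abs_of_pos (Real.exp_pos _), abs_of_nonneg hu]
  have hsin : ‖Complex.sin (z * u)‖ * u ≤ Real.exp ((Y + 1) * u) := by
    have h1 : ‖Complex.sin (z * u)‖ ≤ Real.exp (Y * u) := by
      refine (norm_sin_le_exp_abs_im _).trans (Real.exp_monotone ?_)
      rw [show (z * (u : ℂ)).im = z.im * u by simp, abs_mul, abs_of_nonneg hu]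
      exact mul_le_mul_of_nonneg_right hz hu
    have h2 : u ≤ Real.exp u := by have := Real.add_one_le_exp u; linarith
    calc ‖Complex.sin (z * u)‖ * u ≤ Real.exp (Y * u) * Real.exp u :=
          mul_le_mul h1 h2 hu (Real.exp_pos _).le
      _ = Real.exp ((Y + 1) * u) := by rw [← Real.exp_add]; ring_nf
  have hexp : Real.exp (t * u ^ 2) ≤ Real.exp (T * u ^ 2) := Real.exp_monotone (by nlinarith)
  calc Real.exp (t * u ^ 2) * |deBruijnPhi u| * (‖Complex.sin (z * ↑u)‖ * u)
      ≤ Real.exp (T * u ^ 2) * |deBruijnPhi u| * Real.exp ((Y + 1) * u) := by gcongr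

/-- **Integrability of the dominating function**: `e^{T u²} Φ(u) e^{Y u} ≤ C' e^{−u}` on
`(0, ∞)`, because `T u² + (Y + 10) u ≤ A e^{2u}` and `A e^{2u} − π e^{4u} ≤ A² / (4π)`. [folklore] -/
theorem integrableOn_deBruijnHBound (T Y : ℝ) : IntegrableOn (deBruijnHBound T Y) (Ioi 0) := by
  obtain ⟨C, hC⟩ : ∃ C, ∀ u, 0 ≤ u → |deBruijnPhi u| ≤ C * Real.exp (9 * u - π * Real.exp (4 * u)) :=
    ⟨_, fun u hu ↦ abs_deBruijnPhi_le hu⟩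
  set A : ℝ := |T| + |Y| + 10 with hA
  set K : ℝ := A ^ 2 / (4 * π) with hK
  have hg : IntegrableOn (fun u : ℝ ↦ |C| * Real.exp K * Real.exp (-u)) (Ioi 0) :=
    (integrableOn_exp_neg_Ioi 0).const_mul _
  refine hg.mono' ((continuousOn_deBruijnHBound T Y).mono Ioi_subset_Ici_self
    |>.aestronglyMeasurable measurableSet_Ioi) (ae_restrict_of_forall_mem measurableSet_Ioi ?_)
  intro u (hu : 0 < u)
  have hu' : 0 ≤ u := hu.le
  rw [Real.norm_eq_abs, abs_of_nonneg (deBruijnHBound_nonneg _ _ _), deBruijnHBound]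
  -- the exponent estimate
  set x : ℝ := Real.exp (2 * u) with hxdef
  have hx : 0 < x := Real.exp_pos _
  have h4 : Real.exp (4 * u) = x ^ 2 := by
    rw [hxdef, ← Real.exp_nat_mul]; ring_nf
  have hpoly : T * u ^ 2 + Y * u + 9 * u + u ≤ A * x := by
    have h1 : T * u ^ 2 ≤ |T| * x :=
      (mul_le_mul_of_nonneg_right (le_abs_self T) (sq_nonneg u)).trans
        (mul_le_mul_of_nonneg_left (sq_le_exp_two_mul hu') (abs_nonneg T))
    have h2 : Y * u ≤ |Y| * x :=
      (mul_le_mul_of_nonneg_right (le_abs_self Y) hu').trans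
        (mul_le_mul_of_nonneg_left (self_le_exp_two_mul hu') (abs_nonneg Y))
    have h3 : 9 * u + u ≤ 10 * x := by linarith [self_le_exp_two_mul hu']
    rw [hA]; linarith
  have hquad : A * x - π * Real.exp (4 * u) ≤ K := by
    rw [h4, hK]
    have hπ : (0 : ℝ) < 4 * π := by positivity
    have hid : A * x - π * x ^ 2 = A ^ 2 / (4 * π) - (A - 2 * π * x) ^ 2 / (4 * π) := by
      field_simp
      ring
    rw [hid]
    linarith [div_nonneg (sq_nonneg (A - 2 * π * x)) hπ.le]
  have hexp : Real.exp (T * u ^ 2) * Real.exp (9 * u - π * Real.exp (4 * u)) * Real.exp (Y * u) ≤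
      Real.exp K * Real.exp (-u) := by
    rw [← Real.exp_add, ← Real.exp_add, ← Real.exp_add]
    exact Real.exp_monotone (by linarith)
  calc Real.exp (T * u ^ 2) * |deBruijnPhi u| * Real.exp (Y * u)
      ≤ Real.exp (T * u ^ 2) * (|C| * Real.exp (9 * u - π * Real.exp (4 * u))) *
          Real.exp (Y * u) := by
        gcongr
        exact (hC u hu').trans (by gcongr; exact le_abs_self C)
    _ = |C| * (Real.exp (T * u ^ 2) * Real.exp (9 * u - π * Real.exp (4 * u)) *
          Real.exp (Y * u)) := by ring
    _ ≤ |C| * (Real.exp K * Real.exp (-u)) := by gcongr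
    _ = |C| * Real.exp K * Real.exp (-u) := by ring

/-! ## Measurability and integrability of the integrand -/

/-- Continuity on `(0, ∞)` of `u ↦ e^{tu²} Φ(u) g(u)` for continuous `g`. [folklore] -/
theorem continuousOn_weight_mul {t : ℝ} {g : ℝ → ℂ} (hg : Continuous g) :
    ContinuousOn (fun u : ℝ ↦ (Real.exp (t * u ^ 2) * deBruijnPhi u : ℂ) * g u) (Ioi 0) := by
  have hΦ : ContinuousOn (fun u : ℝ ↦ (deBruijnPhi u : ℂ)) (Ioi 0) :=
    Complex.continuous_ofReal.comp_continuousOn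
      (continuousOn_deBruijnPhi_Ici.mono Ioi_subset_Ici_self)
  have hE : Continuous fun u : ℝ ↦ ((Real.exp (t * u ^ 2) : ℝ) : ℂ) :=
    Complex.continuous_ofReal.comp (by fun_prop)
  exact (hE.continuousOn.mul hΦ).mul hg.continuousOn

/-- `u ↦ cos(zu)` is continuous. [folklore] -/
theorem continuous_cos_const_mul (z : ℂ) : Continuous fun u : ℝ ↦ Complex.cos (z * u) :=
  Complex.continuous_cos.comp (continuous_const.mul Complex.continuous_ofReal)

/-- `u ↦ −u sin(zu)` is continuous. [folklore] -/
theorem continuous_neg_sin_const_mul_mul (z : ℂ) :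
    Continuous fun u : ℝ ↦ -Complex.sin (z * u) * u :=
  (Complex.continuous_sin.comp (continuous_const.mul Complex.continuous_ofReal)).neg.mul
    Complex.continuous_ofReal

/-- The integrand is continuous on `(0, ∞)`. [folklore] -/
theorem continuousOn_deBruijnHIntegrand (t : ℝ) (z : ℂ) :
    ContinuousOn (deBruijnHIntegrand t z) (Ioi 0) :=
  continuousOn_weight_mul (continuous_cos_const_mul z)

/-- The derived integrand is continuous on `(0, ∞)`. [folklore] -/
theorem continuousOn_deBruijnHIntegrand' (t : ℝ) (z : ℂ) :
    ContinuousOn (deBruijnHIntegrand' t z) (Ioi 0) :=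
  continuousOn_weight_mul (continuous_neg_sin_const_mul_mul z)

/-- The integrand is a.e. strongly measurable on `(0, ∞)`. [folklore] -/
theorem aestronglyMeasurable_deBruijnHIntegrand (t : ℝ) (z : ℂ) :
    AEStronglyMeasurable (deBruijnHIntegrand t z) (volume.restrict (Ioi 0)) :=
  (continuousOn_deBruijnHIntegrand t z).aestronglyMeasurable measurableSet_Ioi

/-- The integral defining `H_t(z)` converges absolutely. [cite: Bruijn1950] -/
theorem integrableOn_deBruijnHIntegrand (t : ℝ) (z : ℂ) :
    IntegrableOn (deBruijnHIntegrand t z) (Ioi 0) :=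
  (integrableOn_deBruijnHBound t |z.im|).mono' (aestronglyMeasurable_deBruijnHIntegrand t z)
    (ae_restrict_of_forall_mem measurableSet_Ioi fun _ hu ↦
      norm_deBruijnHIntegrand_le le_rfl le_rfl (le_of_lt hu))

/-! ## `H_t` is entire -/

/-- `|Im z| ≤ |Im z₀| + r` on `ball z₀ r`. [folklore] -/
theorem abs_im_le_of_mem_ball {z z₀ : ℂ} {r : ℝ} (hz : z ∈ Metric.ball z₀ r) :
    |z.im| ≤ |z₀.im| + r := by
  have h1 : |z.im - z₀.im| ≤ ‖z - z₀‖ := by simpa using abs_im_le_norm (z - z₀)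
  have h2 : ‖z - z₀‖ < r := by rwa [Metric.mem_ball, dist_eq_norm] at hz
  have := abs_sub_abs_le_abs_sub z.im z₀.im
  linarith

/-- The integrand is holomorphic in `z` with derivative `deBruijnHIntegrand'`. [folklore] -/
theorem hasDerivAt_deBruijnHIntegrand (t u : ℝ) (z : ℂ) :
    HasDerivAt (fun w : ℂ ↦ deBruijnHIntegrand t w u) (deBruijnHIntegrand' t z u) z := by
  unfold deBruijnHIntegrand deBruijnHIntegrand'
  exact (hasDerivAt_mul_const (u : ℂ)).ccos.const_mul _

/-- Differentiation under the integral sign: `H_t'(z₀) = ∫₀^∞ e^{tu²} Φ(u) (−u sin(z₀ u)) du`.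
[cite: Bruijn1950] -/
theorem hasDerivAt_deBruijnH (t : ℝ) (z₀ : ℂ) :
    HasDerivAt (deBruijnH t) (∫ u in Ioi (0 : ℝ), deBruijnHIntegrand' t z₀ u) z₀ :=
  (hasDerivAt_integral_of_dominated_loc_of_deriv_le (μ := volume.restrict (Ioi 0))
    (F := deBruijnHIntegrand t) (F' := deBruijnHIntegrand' t) (x₀ := z₀)
    (bound := deBruijnHBound t (|z₀.im| + 1 + 1)) (Metric.ball_mem_nhds z₀ one_pos)
    (Eventually.of_forall fun z ↦ aestronglyMeasurable_deBruijnHIntegrand t z)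
    (integrableOn_deBruijnHIntegrand t z₀)
    ((continuousOn_deBruijnHIntegrand' t z₀).aestronglyMeasurable measurableSet_Ioi)
    (ae_restrict_of_forall_mem measurableSet_Ioi fun _ hu _ hz ↦
      norm_deBruijnHIntegrand'_le le_rfl (abs_im_le_of_mem_ball hz) (le_of_lt hu))
    (integrableOn_deBruijnHBound _ _)
    (ae_restrict_of_forall_mem measurableSet_Ioi fun u _ z _ ↦
      hasDerivAt_deBruijnHIntegrand t u z)).2

/-- **Discharge** of `Literature.NumberTheory.LFunctions.differentiable_deBruijnH`: every `H_t` is entire. [cite: Bruijn1950] -/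
theorem differentiable_deBruijnH_holds : differentiable_deBruijnH :=
  fun t z ↦ (hasDerivAt_deBruijnH t z).differentiableAt

/-! ## Joint continuity of `(t, z) ↦ H_t(z)` -/

/-- `(t, z) ↦ H_t(z)` is jointly continuous on `ℝ × ℂ` (dominated convergence with the bound
`e^{(t₀+1)u²} Φ(u) e^{(|Im z₀|+1)u}` near `(t₀, z₀)`). [folklore] -/
theorem continuous_deBruijnH_uncurry : Continuous fun p : ℝ × ℂ ↦ deBruijnH p.1 p.2 := by
  refine continuous_iff_continuousAt.2 fun p₀ ↦ ?_
  change ContinuousAt (fun p : ℝ × ℂ ↦ ∫ u in Ioi (0 : ℝ), deBruijnHIntegrand p.1 p.2 u) p₀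
  refine continuousAt_of_dominated (bound := deBruijnHBound (p₀.1 + 1) (|p₀.2.im| + 1))
    (Eventually.of_forall fun p ↦ aestronglyMeasurable_deBruijnHIntegrand p.1 p.2) ?_
    (integrableOn_deBruijnHBound _ _) ?_
  · filter_upwards [Metric.ball_mem_nhds p₀ one_pos] with p hp
    refine ae_restrict_of_forall_mem measurableSet_Ioi fun u hu ↦ ?_
    rw [← ball_prod_same, Set.mem_prod] at hp
    refine norm_deBruijnHIntegrand_le ?_ (abs_im_le_of_mem_ball hp.2) (le_of_lt hu)
    have := hp.1
    rw [Metric.mem_ball, Real.dist_eq] at this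
    linarith [le_abs_self (p.1 - p₀.1)]
  · refine Eventually.of_forall fun u ↦ ?_
    have hc : Continuous fun p : ℝ × ℂ ↦ Complex.cos (p.2 * (u : ℂ)) := by fun_prop
    have he : Continuous fun p : ℝ × ℂ ↦ ((Real.exp (p.1 * u ^ 2) : ℝ) : ℂ) :=
      Complex.continuous_ofReal.comp (by fun_prop)
    exact ((he.mul continuous_const).mul hc).continuousAt

/-! ## `H_t(0) > 0` -/

/-- `H_t(0) = ∫₀^∞ e^{tu²} Φ(u) du` (a real number). [folklore] -/
theorem deBruijnH_apply_zero (t : ℝ) :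
    deBruijnH t 0 = ((∫ u in Ioi (0 : ℝ), Real.exp (t * u ^ 2) * deBruijnPhi u : ℝ) : ℂ) := by
  rw [deBruijnH_eq_integral, ← integral_complex_ofReal]
  refine setIntegral_congr_fun measurableSet_Ioi fun u _ ↦ ?_
  simp [deBruijnHIntegrand]

/-- `∫₀^∞ e^{tu²} Φ(u) du > 0`, since `Φ > 0` on `[0, ∞)` and the integrand is integrable.
[folklore] -/
theorem deBruijnH_apply_zero_pos (t : ℝ) :
    0 < ∫ u in Ioi (0 : ℝ), Real.exp (t * u ^ 2) * deBruijnPhi u := by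
  have hint : IntegrableOn (fun u : ℝ ↦ Real.exp (t * u ^ 2) * deBruijnPhi u) (Ioi 0) := by
    refine (integrableOn_deBruijnHBound t 0).mono' ?_
      (ae_restrict_of_forall_mem measurableSet_Ioi fun u hu ↦ ?_)
    · refine ContinuousOn.aestronglyMeasurable ?_ measurableSet_Ioi
      exact (by fun_prop : Continuous fun u : ℝ ↦ Real.exp (t * u ^ 2)).continuousOn.mul
        (continuousOn_deBruijnPhi_Ici.mono Ioi_subset_Ici_self)
    · rw [deBruijnHBound, Real.norm_eq_abs, abs_mul, abs_of_pos (Real.exp_pos _)]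
      simp
  refine (setIntegral_pos_iff_support_of_nonneg_ae
    (ae_restrict_of_forall_mem measurableSet_Ioi fun u hu ↦ ?_) hint).2 ?_
  · exact (mul_pos (Real.exp_pos _) (deBruijnPhi_pos_of_nonneg (le_of_lt hu))).le
  · have : Function.support (fun u : ℝ ↦ Real.exp (t * u ^ 2) * deBruijnPhi u) ∩ Ioi 0 = Ioi 0 := by
      refine Set.inter_eq_right.2 fun u hu ↦ ?_
      exact (mul_pos (Real.exp_pos _) (deBruijnPhi_pos_of_nonneg (le_of_lt hu))).ne'
    rw [this, Real.volume_Ioi]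
    exact ENNReal.zero_lt_top

/-- No `H_t` vanishes identically: `H_t(0) ≠ 0`. [folklore] -/
theorem deBruijnH_apply_zero_ne_zero (t : ℝ) : deBruijnH t 0 ≠ 0 := by
  rw [deBruijnH_apply_zero, Ne, Complex.ofReal_eq_zero]
  exact (deBruijnH_apply_zero_pos t).ne'

/-- No `H_t` is the zero function. [folklore] -/
theorem exists_deBruijnH_ne_zero (t : ℝ) : ∃ z : ℂ, deBruijnH t z ≠ 0 :=
  ⟨0, deBruijnH_apply_zero_ne_zero t⟩

end Literature.NumberTheory.LFunctions

end
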